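import Summits.MatrixMultiplication.OmegaCensus.DihedralLawModOneTwoCosets
import Mathlib.GroupTheory.OrderOfElement
import HarnessLib

/-!
# No `(2,2,2q)` law triple over `A` whose cyclic subgroups all have index ≥ 3

ω-census, family (b3).  Framing: lottery ticket; floor = certified bounds/negative ranges.

Corollary of `two_cosets_of_two_two_law`: if a dihedral-like group over `A` (`|A| ≡ 1 (mod 3)`, `|A| ≥ 7`) has a
TPP triple with `|S| = |T| = 2` attaining the law `3|S||T||U| + 8 = 8|A|`, then `|A| ≤ 2 · ord(g)` for some `g ∈ A`
(`card_le_two_mul_addOrderOf_of_two_two_law`).  Hence if every element of `A` has order `< |A|/2` — e.g.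
`A = ℤ₄ × ℤ₄`, `ℤ₂² × ℤ₄`, `ℤ₂⁴`, `ℤ₅ × ℤ₅` — no such triple exists (`no_two_two_law_of_small_orders`); for
`Dih(ℤ₄ × ℤ₄)` this is the census datum "pattern `(2,2,10)` UNSAT" (kit j097820) as a theorem, and for `Dih(ℤ₅²)`
it excludes the pattern `(2,2,16)`.
-/

namespace Summit.MatrixMultiplication.OmegaCensus

open Literature.Combinatorics.Additive Finset

section DihedralLike

variable {A : Type*} [AddCommGroup A] [DecidableEq A] [Fintype A] {G : Type} [Group G] [DecidableEq G]
  {ρ τ : A → G} {c₀ : A} {S T U : Finset G}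

omit [DecidableEq A] in
/-- Two cosets of `⟨g⟩` cover at most `2 · ord(g)` elements. [folklore] -/
theorem card_le_two_mul_addOrderOf_of_two_cosets {g a b : A}
    (h : ∀ x : A, x - a ∈ AddSubgroup.zmultiples g ∨ x - b ∈ AddSubgroup.zmultiples g) :
    Fintype.card A ≤ 2 * addOrderOf g := by
  classical
  set D := AddSubgroup.zmultiples g with hD
  have hcardD : (univ.filter fun y : A => y ∈ D).card = addOrderOf g := by
    rw [← Nat.card_zmultiples g, ← hD, Nat.card_eq_fintype_card, ← Fintype.card_coe]
    refine Fintype.card_congr (Equiv.subtypeEquiv (Equiv.refl A) fun x => ?_)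
    simp
  have Kcard : ∀ x : A, (univ.filter fun y => y - x ∈ D).card = addOrderOf g := by
    intro x
    have hK : (univ.filter fun y => y ∈ D).image (fun y => y + x) = univ.filter fun y => y - x ∈ D := by
      ext y
      simp only [mem_image, mem_filter, mem_univ, true_and]
      constructor
      · rintro ⟨z, hz, rfl⟩; simpa using hz
      · intro hy; exact ⟨y - x, hy, sub_add_cancel y x⟩
    rw [← hcardD, ← hK, card_image_of_injective _ (add_left_injective x)]
  have hcov : (univ : Finset A) ⊆ (univ.filter fun y => y - a ∈ D) ∪ (univ.filter fun y => y - b ∈ D) := by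
    intro x _
    rcases h x with hx | hx
    · exact mem_union_left _ (mem_filter.2 ⟨mem_univ x, hx⟩)
    · exact mem_union_right _ (mem_filter.2 ⟨mem_univ x, hx⟩)
  calc Fintype.card A = (univ : Finset A).card := card_univ.symm
    _ ≤ ((univ.filter fun y => y - a ∈ D) ∪ (univ.filter fun y => y - b ∈ D)).card := card_le_card hcov
    _ ≤ (univ.filter fun y => y - a ∈ D).card + (univ.filter fun y => y - b ∈ D).card := card_union_le _ _
    _ = 2 * addOrderOf g := by rw [Kcard a, Kcard b]; ring

/-- A `(2,2,·)` TPP triple attaining the law at `|A| ≡ 1 (mod 3)` forces an element of order `≥ |A|/2`.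
[folklore] -/
theorem card_le_two_mul_addOrderOf_of_two_two_law
    (hρρ : ∀ a b, ρ a * ρ b = ρ (a + b)) (hρτ : ∀ a b, ρ a * τ b = τ (b - a))
    (hτρ : ∀ a b, τ a * ρ b = τ (a + b)) (hττ : ∀ a b, τ a * τ b = ρ (c₀ + b - a))
    (hρ : Function.Injective ρ) (hτ : Function.Injective τ) (hne : ∀ a b, ρ a ≠ τ b)
    (hsurj : ∀ g, (∃ a, ρ a = g) ∨ (∃ a, τ a = g)) (hmod : Fintype.card A % 3 = 1) (hA : 7 ≤ Fintype.card A)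
    (h : TripleProductProperty S T U) (hS : S.card = 2) (hT : T.card = 2)
    (hV : 3 * (S.card * T.card * U.card) + 8 = 8 * Fintype.card A) :
    ∃ g : A, Fintype.card A ≤ 2 * addOrderOf g := by
  obtain ⟨g, a, b, hab⟩ := two_cosets_of_two_two_law hρρ hρτ hτρ hττ hρ hτ hne hsurj hmod hA h hS hT hV
  exact ⟨g, card_le_two_mul_addOrderOf_of_two_cosets hab⟩

/-- **No `(2,2,·)` law triple over `A` with small element orders**: if `2 · ord(g) < |A|` for every `g ∈ A`
(`|A| ≡ 1 (mod 3)`, `|A| ≥ 7`), then no TPP triple with `|S| = |T| = 2` attains `3|S||T||U| + 8 = 8|A|`.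
[folklore] -/
theorem no_two_two_law_of_small_orders
    (hρρ : ∀ a b, ρ a * ρ b = ρ (a + b)) (hρτ : ∀ a b, ρ a * τ b = τ (b - a))
    (hτρ : ∀ a b, τ a * ρ b = τ (a + b)) (hττ : ∀ a b, τ a * τ b = ρ (c₀ + b - a))
    (hρ : Function.Injective ρ) (hτ : Function.Injective τ) (hne : ∀ a b, ρ a ≠ τ b)
    (hsurj : ∀ g, (∃ a, ρ a = g) ∨ (∃ a, τ a = g)) (hmod : Fintype.card A % 3 = 1) (hA : 7 ≤ Fintype.card A)
    (hord : ∀ g : A, 2 * addOrderOf g < Fintype.card A)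
    (h : TripleProductProperty S T U) (hS : S.card = 2) (hT : T.card = 2) :
    3 * (S.card * T.card * U.card) + 8 ≠ 8 * Fintype.card A := by
  intro hV
  obtain ⟨g, hg⟩ := card_le_two_mul_addOrderOf_of_two_two_law hρρ hρτ hτρ hττ hρ hτ hne hsurj hmod hA h hS hT hV
  exact absurd (hord g) (not_lt.2 hg)

end DihedralLike

end Summit.MatrixMultiplication.OmegaCensus
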